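import Literature.Probability.LatticeModels.IsingFieldModel
import HarnessLib

/-!
# Ding–Song–Sun 2022, Theorem 1.1: the influence of a signed field perturbation is maximal with
everything else switched off (named fact)

Topic `Probability/LatticeModels`; companion of `IsingFieldModel.lean` (the finite-volume Ising
model with a site-dependent field, `fieldExpect`). Consumer: the crux `SignedFieldDomination`
(item `stmt-CriticalPhenomena-8276`) of the route
`Summits/CriticalPhenomena/Ising3DConformalLimit/Theses/SignedFieldRestoration`, whose Lean
statement the fact below reproduces token for token.

Source read (2026-08-15): J. Ding, J. Song, R. Sun, *A new correlation inequality for Ising models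
with external fields*, Probab. Theory Relat. Fields 186 (2023) 477–492 = arXiv:2107.09243 (held),
§1, verbatim. Setting: "Let `G = (V, E)` be a finite graph […] Given coupling constants
`J : E → [0,∞)`, inverse temperature `β ∈ (0,∞)`, and external field `g : V → [-∞, ∞]`, we define
the Ising model on spin configurations `σ ∈ {±1}^V` via the Gibbs measure
`μ_g(σ) = Z_g⁻¹ exp{β ∑_{u∼v} J_{uv} σ_uσ_v + ∑_{u∈V} g_u σ_u}` […] Since `β` can be absorbed by the
coupling constants `J`, we will assume `β = 1` […] We will denote expectation with respect to
`μ_g` by `⟨·⟩_g`. Note that when `g_u = ±∞` for some `u ∈ V`, we must have `σ_u = ±1`, which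
effectively imposes a boundary condition at `u` (this boundary condition has the same effect as
removing `u` from the graph and adding an extra field `±J_{uv}` to each neighbour `v ∼ u` if
`g_u = ±∞`)." — "**Theorem 1.1.** Let `g : V → [-∞, ∞]` and `h : V → [0, ∞]` be such that
`min{|g_v|, h_v} < ∞` for all `v ∈ V`. Then for any `o ∈ V`,
`⟨σ_o⟩_{g+h} - ⟨σ_o⟩_{g-h} ≤ ⟨σ_o⟩_h - ⟨σ_o⟩_{-h}`." (Remark 1.2: the tempting monotone form in
`λg` is FALSE, App. A; Cor. 1.3: `⟨σ_uσ_v⟩_g - ⟨σ_u⟩_g⟨σ_v⟩_g ≤ ⟨σ_uσ_v⟩_0`; Remark 1.5: both hold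
in the Griffiths–Simon class. Proof: §2, an elementary induction on `(|V|, |{h > 0}|)`.)

## Transcription onto the tree's finite-volume vocabulary (`fieldExpect G Λ β h bc f`)

The tree's Gibbs factor is `exp{-βℋ} = exp{β ∑_{e ∈ ℰ^{bc}_Λ} σ_e + β ∑_{x∈Λ} h_x σ_x}`
(`fieldHamiltonian`): couplings `J ≡ β ≥ 0` on the edges of `G` inside `Λ` (free) — plus, for a
fixed boundary condition `η`, the edges from `Λ` to `Λᶜ`, whose frozen outer spins contribute the
site field `β ∑_{y∼x, y∉Λ} η_y` at `x ∈ Λ`, exactly Ding–Song–Sun's reading of `±∞` fields /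
boundary spins as extra fields on the neighbours — and fields `βh_x`. So, for a finite volume `Λ`
of a locally finite graph, `β ≥ 0`, a boundary condition `bc` COMMON TO BOTH TERMS ON THE LEFT
(absorbed, together with `βg`, into the printed `g ∈ ℝ^V`), any `g : V → ℝ` and any `f ≥ 0`
(the printed `h = βf ∈ [0,∞)^V`), Theorem 1.1 on the finite graph `Λ` reads
`⟨σ_o⟩^{bc}_{Λ;β,g+f} - ⟨σ_o⟩^{bc}_{Λ;β,g-f} ≤ ⟨σ_o⟩^{free}_{Λ;β,f} - ⟨σ_o⟩^{free}_{Λ;β,-f}`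
for `o ∈ Λ`; for `o ∉ Λ` both sides vanish (the spin at `o` is glued to the boundary datum, the
same in the two terms of each side), so the statement is kept for all `o : V`, as the consumer
filed it. The right side is the FREE measure with no other field: keeping `bc` there would be a
different, stronger inequality (route note), and the nearby monotone variants are false
(Remark 1.2). Only finite fields occur in the transcription (`min{|g_v|, h_v} < ∞` is automatic).

## Content

* `DingSongSun2022_signedFieldDomination` (named fact, D-0014) — Theorem 1.1 as above; its body is
  the consumer's `SignedFieldDomination` verbatim. Not proved here (the printed proof is a
  four-page induction with `tanh` algebra and FKG on finite sums — a realistic later discharge in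
  this file, SIZE L); Cor. 1.3 is not vendored.
* PROVED: `DingSongSun2022_signedFieldDomination.of_zero` — at `f = 0` both sides vanish (the
  rendering is tight there), and the unfolding `apply`.

## References

* [DingSongSun2022] J. Ding, J. Song, R. Sun, Probab. Theory Relat. Fields 186 (2023) 477–492 =
  arXiv:2107.09243, §1 Theorem 1.1, Remarks 1.2, 1.5, Corollary 1.3; §2 (proof).
* [FriedliVelenik2017] S. Friedli, Y. Velenik, Statistical Mechanics of Lattice Systems, §3.1,
  §3.8.1 eq. (3.51) (the finite-volume model of `IsingFieldModel`).
-/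

noncomputable section

open MeasureTheory Finset

namespace Literature.Probability.LatticeModels

/-- NAMED FACT — **Ding–Song–Sun 2022, Theorem 1.1 (signed-field domination of the boundary
influence).** "Let `g : V → [-∞, ∞]` and `h : V → [0, ∞]` be such that `min{|g_v|, h_v} < ∞`
for all `v ∈ V`. Then for any `o ∈ V`, `⟨σ_o⟩_{g+h} - ⟨σ_o⟩_{g-h} ≤ ⟨σ_o⟩_h - ⟨σ_o⟩_{-h}`"
(ferromagnetic Ising model on a finite graph, `J ≥ 0`). In the tree's finite-volume vocabulary
(module docstring: couplings `β ≥ 0` on the edges of `Λ`, the boundary condition `bc` — common to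
both terms on the left — and `βg` absorbed into the printed `g`, `h = βf`): for a locally finite
graph `G`, a finite volume `Λ`, `β ≥ 0`, any `g : V → ℝ`, any `f ≥ 0`, any boundary condition
`bc` and any site `o`,
`⟨σ_o⟩^{bc}_{Λ;β,g+f} - ⟨σ_o⟩^{bc}_{Λ;β,g-f} ≤ ⟨σ_o⟩^{free}_{Λ;β,f} - ⟨σ_o⟩^{free}_{Λ;β,-f}`.
The body is, token for token, the consumer's crux
`Summit.CriticalPhenomena.Ising3DConformalLimit.Theses.SignedFieldRestoration.SignedFieldDomination`.
Users take `(h : DingSongSun2022_signedFieldDomination)`.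
[cite: DingSongSun2022, Theorem 1.1 (§1), with the boundary-condition-as-field remark preceding it] -/
def DingSongSun2022_signedFieldDomination : Prop :=
  ∀ (V : Type) (G : SimpleGraph V) [DecidableEq V] [G.LocallyFinite] (Λ : Finset V) (β : ℝ),
    0 ≤ β → ∀ (g f : V → ℝ), (∀ v, 0 ≤ f v) → ∀ (bc : BoundaryCondition V) (o : V),
      fieldExpect G Λ β (g + f) bc (spinAt o) - fieldExpect G Λ β (g - f) bc (spinAt o) ≤
        fieldExpect G Λ β f .free (spinAt o) - fieldExpect G Λ β (-f) .free (spinAt o)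

namespace DingSongSun2022_signedFieldDomination

/-- Unfolding of the fact at given data. [cite: DingSongSun2022, Theorem 1.1] -/
theorem apply (h : DingSongSun2022_signedFieldDomination) {V : Type} (G : SimpleGraph V)
    [DecidableEq V] [G.LocallyFinite] (Λ : Finset V) {β : ℝ} (hβ : 0 ≤ β) (g : V → ℝ)
    {f : V → ℝ} (hf : ∀ v, 0 ≤ f v) (bc : BoundaryCondition V) (o : V) :
    fieldExpect G Λ β (g + f) bc (spinAt o) - fieldExpect G Λ β (g - f) bc (spinAt o) ≤
      fieldExpect G Λ β f .free (spinAt o) - fieldExpect G Λ β (-f) .free (spinAt o) :=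
  h V G Λ β hβ g f hf bc o

/-- **The rendering is tight at `f = 0`**: with no perturbation both sides of the inequality
vanish (`g + 0 = g - 0`, `0 = -0`), so Theorem 1.1 holds with equality there — proved outright,
a sanity check of the transcription. [cite: DingSongSun2022, Theorem 1.1] -/
theorem of_zero {V : Type} (G : SimpleGraph V) [DecidableEq V] [G.LocallyFinite] (Λ : Finset V)
    (β : ℝ) (g : V → ℝ) (bc : BoundaryCondition V) (o : V) :
    fieldExpect G Λ β (g + 0) bc (spinAt o) - fieldExpect G Λ β (g - 0) bc (spinAt o) =
        fieldExpect G Λ β 0 .free (spinAt o) - fieldExpect G Λ β (-0) .free (spinAt o) ∧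
      fieldExpect G Λ β 0 .free (spinAt o) - fieldExpect G Λ β (-0) .free (spinAt o) = 0 := by
  rw [add_zero, sub_zero, neg_zero, sub_self, sub_self]
  exact ⟨rfl, rfl⟩

end DingSongSun2022_signedFieldDomination

end Literature.Probability.LatticeModels

end
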